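import Summits.NavierStokesRegularity.NavierStokesRegularity.Theorems.StrainDoorsPeakDoorsLargeConstant
import HarnessLib

/-!
# StrainDoorsPeakDoorsSpectrum — the `κ`-SPECTRUM of PART K's three doors

LEAD plate of the S-door lane (ns-s30-p1 g6; helper lane of `stmt-NavierStokesRegularity-0056`, rung N0;
`--supports stmt-NavierStokesRegularity-0056 --as helper`).  No new definitions; no sorry.  Bookkeeping that locates
the content of PART K's one-parameter door families exactly (with `B(C₀)` of `peak_geometry_lt`):

* K-α `PeakConcavityFloor C₀ κ` and K-β `PeakTwistFloor C₀ κ`: FREE for `κ ≤ 0` (`Δ|ω̄| ≤ 0` at the record,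
  `|∇ξ̄|²_F ≥ 0`); EQUIVALENT to `PeakClassEmpty C₀` for `κ ≥ B(C₀)` (`StrainDoorsPeakDoorsLargeConstant`); OPEN in between;
* K-γ `PeakStretchingCap C₀ κ`: EQUIVALENT to `PeakClassEmpty C₀` for `κ ≤ 0` (the record law `(0+1)ᾱ ≥ 1 + (0+1)|∇ξ̄|²_F`);
  FREE for `κ ≥ B(C₀)`; OPEN in between.
So each door family interpolates between a triviality and door K-δ = the Type-I Liouville statement
(`peakClassEmpty_iff_typeI_liouville`), and `0056`'s share of PART K is precisely the window `0 < κ < B(C₀)`.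

WHAT THIS IS NOT: statements about a HYPOTHETICAL profile class; `B(C₀)` ineffective; `0056` / `10661` / NS regularity
NOT proved.
-/

noncomputable section

open MeasureTheory Set Function Filter Metric Real InnerProductSpace
open _root_.Topology
open scoped ENNReal NNReal RealInnerProductSpace ContDiff Laplacian
open Literature.Analysis Literature.Analysis.FluidPDE
open Literature.Analysis.FluidPDE.VorticityDirectionDynamics

set_option linter.dupNamespace false

namespace Summit.NavierStokesRegularity.NavierStokesRegularity.Theorems.StrainDoors

open Summit.NavierStokesRegularity.NavierStokesRegularity.Theorems.ArgmaxDoors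

/-! ## The free ends -/

/-- K-α is FREE for `κ ≤ 0`: at an attained record `Δ|ω̄| ≤ 0` (`IsTypeITangentPeak.record_identity`), so the scale-free
concavity `(−Δ|ω̄|)(z̄)/ρ̄` is `≥ 0 ≥ κ`. -/
theorem peakConcavityFloor_of_nonpos {C₀ κ : ℝ} (hκ : κ ≤ 0) : PeakConcavityFloor C₀ κ := by
  intro v zbar h
  obtain ⟨-, -, hlap, -, -, -⟩ := h.record_identity
  have hρ : 0 < ‖curl (v (-1)) zbar‖ := norm_pos_iff.mpr h.2.2.2.1
  exact hκ.trans (div_nonneg (by linarith) hρ.le)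

/-- K-β is FREE for `κ ≤ 0` (`|∇ξ̄|²_F ≥ 0`). -/
theorem peakTwistFloor_of_nonpos {C₀ κ : ℝ} (hκ : κ ≤ 0) : PeakTwistFloor C₀ κ :=
  fun v zbar _ => hκ.trans (frobeniusNormSq_nonneg (fderiv ℝ (vorticityDirection (curl (v (-1)))) zbar))

/-- On an EMPTY class every door is vacuous. -/
theorem peak_doors_of_peakClassEmpty {C₀ : ℝ} (hE : PeakClassEmpty C₀) (κ : ℝ) :
    PeakConcavityFloor C₀ κ ∧ PeakTwistFloor C₀ κ ∧ PeakStretchingCap C₀ κ :=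
  ⟨fun v zbar h => (hE v zbar h).elim, fun v zbar h => (hE v zbar h).elim, fun v zbar h => (hE v zbar h).elim⟩

/-! ## The Liouville-strength ends -/

/-- ★★ **K-γ with `κ ≤ 0` IS door K-δ**: `PeakStretchingCap C₀ κ ↔ PeakClassEmpty C₀` for `κ ≤ 0` (the free twist floor with
the same `κ` + PART K's `peakClassEmpty_of_twistFloor_of_cap`; conversely an empty class makes the cap vacuous). -/
theorem peakStretchingCap_iff_peakClassEmpty_of_nonpos {C₀ κ : ℝ} (hκ : κ ≤ 0) :
    PeakStretchingCap C₀ κ ↔ PeakClassEmpty C₀ :=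
  ⟨fun hcap => peakClassEmpty_of_twistFloor_of_cap (peakTwistFloor_of_nonpos hκ) hcap,
    fun hE => (peak_doors_of_peakClassEmpty hE κ).2.2⟩

/-- ★★ **K-α with `κ ≥ B(C₀)` IS door K-δ, K-β likewise, and K-γ is FREE there** (one common `B` from `peak_geometry_lt`):
`∃ B ≥ 0, ∀ κ ≥ B, (PeakConcavityFloor C₀ κ ↔ PeakClassEmpty C₀) ∧ (PeakTwistFloor C₀ κ ↔ PeakClassEmpty C₀) ∧
PeakStretchingCap C₀ κ`. -/
theorem peak_doors_spectrum_large (C₀ : ℝ) :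
    ∃ B : ℝ, 0 ≤ B ∧ ∀ (κ : ℝ), B ≤ κ →
      (PeakConcavityFloor C₀ κ ↔ PeakClassEmpty C₀) ∧ (PeakTwistFloor C₀ κ ↔ PeakClassEmpty C₀) ∧
        PeakStretchingCap C₀ κ := by
  obtain ⟨B, hB, hgeo⟩ := peak_geometry_lt C₀
  refine ⟨B, hB, fun κ hκ => ⟨⟨fun hfl v zbar h => ?_, fun hE => (peak_doors_of_peakClassEmpty hE κ).1⟩,
    ⟨fun hfl v zbar h => ?_, fun hE => (peak_doors_of_peakClassEmpty hE κ).2.1⟩, fun v zbar h => ?_⟩⟩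
  · have h1 := (hgeo v zbar h).2.2
    have h2 := hfl v zbar h
    linarith
  · have h1 := (hgeo v zbar h).2.1
    have h2 := hfl v zbar h
    linarith
  · have h1 := (hgeo v zbar h).1
    linarith

/-- ★★ **THE SPECTRUM IN ONE LINE**: with `B(C₀)` as above — for `κ ≤ 0` the two floors hold and the cap is door K-δ; for
`κ ≥ B` the cap holds and the two floors are door K-δ; and door K-δ is the Type-I Liouville statement with constant `C₀`
(`peakClassEmpty_iff_typeI_liouville`, file `StrainDoorsPeakClassLiouvilleIff`).  `0056`'s share of PART K is the window
`0 < κ < B(C₀)`. -/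
theorem peak_doors_spectrum (C₀ : ℝ) :
    ∃ B : ℝ, 0 ≤ B ∧
      (∀ κ : ℝ, κ ≤ 0 → PeakConcavityFloor C₀ κ ∧ PeakTwistFloor C₀ κ ∧ (PeakStretchingCap C₀ κ ↔ PeakClassEmpty C₀)) ∧
      (∀ κ : ℝ, B ≤ κ → (PeakConcavityFloor C₀ κ ↔ PeakClassEmpty C₀) ∧ (PeakTwistFloor C₀ κ ↔ PeakClassEmpty C₀) ∧
        PeakStretchingCap C₀ κ) := by
  obtain ⟨B, hB, hlarge⟩ := peak_doors_spectrum_large C₀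
  exact ⟨B, hB, fun κ hκ => ⟨peakConcavityFloor_of_nonpos hκ, peakTwistFloor_of_nonpos hκ,
    peakStretchingCap_iff_peakClassEmpty_of_nonpos hκ⟩, hlarge⟩

end Summit.NavierStokesRegularity.NavierStokesRegularity.Theorems.StrainDoors

end
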